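import Summits.CriticalPhenomena.PercolationContinuityZ3.Theorems.PercNearOneGluingNoHeavyQuantLawDecAbsorbTA
import HarnessLib

/-!
# QUANT lane R8, T-DEC: law-level DEC(j′) criteria, part D — the EMPTY-ATOM criterion: if the mass at `0` can pay for the giants,
# DEC(j′) holds for every top-affordable law

builds on p205010 (kernel theorem, internal audit signed; external expert review pending)

Support file (`--supports stmt-CriticalPhenomena-4575`), QUANT lane seat prim-quant-census-2 (gen 52), rung R8 of
`run/shared/lean/prim/quant/LADDER.md`; corollary of `LawDec.decAt_of_absorb_meanCondition` (`…QuantLawDecAbsorbTA`, criterion C′ with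
`σ = 0` and the absorbed mass sitting on the atom `0`).  Memo `run/shared/lean/prim/quant/prim-quant-census-2-g52/DEC-CRITERIA-G52.md` §5.
Theorems only (no definitions), standard axioms.

* **`LawDec.decAt_of_atomZero`.**  Law `μ ≥ 0` on `{0..M}` (mass 1, mean `T`), floor `0 < x < 1`, layer `j′ < M`, every charged atom
  affordable (`x·h ≤ T` whenever `μ h > 0` — automatic for heavy blob systems, `x·A ≤ T`), charged atoms `≤ j′` bounded by `h* ` with
  `x·h* ≤ T`.  If `(1 − x)·P(S ≥ j′+1) ≤ x·μ 0` then `Quant.LawDec.DECAt x j′ M μ`: the giants pair with the empty atom at gate `x`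
  (components `{0, h; x}` of mean `x·h ≤ T`), and the remainder — everything else below the layer — has mean `≥ T·mass`, so Lemma P /
  Theorem A decomposes it into components valid at `T` (`rest_of_meanCondition` with `σ = 0`).
Census (memo §5, exact): among the 25 002 instances with floor `≤ 1/2` where criterion E fails (k ≤ 3, gates k/12, sizes ≤ 5), the empty
atom still carries part of its mass after the canonical split in 16 667 — exactly the cases this criterion settles without any first-moment
bookkeeping.

[this work]; DEC rules ARCH-TREES-G49 §2.2 / DEC-TAMP-G50 §3.1, Theorem A / Lemma P DEC-TAMP-G50 §1 (this lane).  The gluing rows served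
[cite: KozmaNitzan2024, Conjecture 3 (p. 15)]; product measure [cite: Grimmett1999, §1.3 p. 10].
-/

noncomputable section

namespace Summit.CriticalPhenomena.PercolationContinuityZ3.Theorems

namespace Quant

open Finset

namespace LawDec

/-- **THE EMPTY-ATOM CRITERION.**  See the file header. [this work] -/
theorem decAt_of_atomZero (x : ℝ) (j' M hstar : ℕ) (μ : ℕ → ℝ) (hjM : j' < M)
    (hμ0 : ∀ h, 0 ≤ μ h) (hμM : ∀ h, M < h → μ h = 0) (hμ1 : ∑ h ∈ Finset.range (M + 1), μ h = 1)
    (hx0 : 0 < x) (hx1 : x < 1)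
    (htop : ∀ h, 0 < μ h → x * (h : ℝ) ≤ ∑ k ∈ Finset.range (M + 1), (k : ℝ) * μ k)
    (hh : ∀ h, h ≤ j' → 0 < μ h → h ≤ hstar) (hhstar : x * (hstar : ℝ) ≤ ∑ k ∈ Finset.range (M + 1), (k : ℝ) * μ k)
    (hzero : (1 - x) * ∑ h ∈ Finset.Ico (j' + 1) (M + 1), μ h ≤ x * μ 0) :
    DECAt x j' M μ := by
  set T : ℝ := ∑ k ∈ Finset.range (M + 1), (k : ℝ) * μ k with hT
  obtain ⟨PG, hPG⟩ : ∃ P : ℝ, P = ∑ h ∈ Finset.Ico (j' + 1) (M + 1), μ h := ⟨_, rfl⟩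
  rw [← hPG] at hzero
  have hPG0 : 0 ≤ PG := by rw [hPG]; exact Finset.sum_nonneg fun h _ => hμ0 h
  have hx0' : x ≠ 0 := ne_of_gt hx0
  -- the absorbed mass: `c = (1-x) PG / x` on the atom 0
  obtain ⟨c, hc⟩ : ∃ c : ℝ, c = (1 - x) * PG / x := ⟨_, rfl⟩
  have hc0 : 0 ≤ c := by rw [hc]; exact div_nonneg (mul_nonneg (by linarith) hPG0) hx0.le
  have hcμ : c ≤ μ 0 := by rw [hc, div_le_iff₀ hx0]; linarith
  set f : ℕ → ℝ := fun h => if h = 0 then c else 0 with hf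
  have hf0 : ∀ h, 0 ≤ f h := fun h => by simp only [hf]; split_ifs <;> [exact hc0; exact le_rfl]
  have hfμ : ∀ h, f h ≤ μ h := fun h => by
    simp only [hf]; split_ifs with h0
    · rw [h0]; exact hcμ
    · exact hμ0 h
  have hfsum : ∑ h ∈ Finset.range (j' + 1), f h = c := by
    rw [Finset.sum_eq_single 0]
    · simp only [hf, if_pos rfl]
    · intro h _ hne; simp only [hf, if_neg hne]
    · intro hn; exact absurd (Finset.mem_range.2 (Nat.succ_pos j')) hn
  have hfmom : ∑ h ∈ Finset.range (j' + 1), (h : ℝ) * f h = 0 := by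
    refine Finset.sum_eq_zero fun h _ => ?_
    simp only [hf]; split_ifs with h0
    · rw [h0, Nat.cast_zero, zero_mul]
    · rw [mul_zero]
  have hbal : x * ∑ h ∈ Finset.range (j' + 1), f h = (1 - x) * ∑ h ∈ Finset.Ico (j' + 1) (M + 1), μ h := by
    rw [hfsum, ← hPG, hc, mul_div_cancel₀ _ hx0']
  -- the giants' first moment is at most `T·PG/x`
  have hEG : ∑ h ∈ Finset.Ico (j' + 1) (M + 1), (h : ℝ) * μ h ≤ T * PG / x := by
    rw [le_div_iff₀ hx0, hPG, Finset.mul_sum, Finset.sum_mul]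
    refine Finset.sum_le_sum fun h _ => ?_
    rcases (hμ0 h).eq_or_lt with hz | hpos
    · rw [← hz, mul_zero, mul_zero, zero_mul]
    · have := htop h hpos
      nlinarith
  -- split of the first moment and of the mass along `j′`
  have hsplitT : ∑ h ∈ Finset.range (j' + 1), (h : ℝ) * μ h + ∑ h ∈ Finset.Ico (j' + 1) (M + 1), (h : ℝ) * μ h = T := by
    rw [Finset.range_eq_Ico, Finset.sum_Ico_consecutive _ (Nat.zero_le _) (by omega), ← Finset.range_eq_Ico]
  have hsplit1 : ∑ h ∈ Finset.range (j' + 1), μ h + PG = 1 := by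
    rw [hPG, Finset.range_eq_Ico, Finset.sum_Ico_consecutive _ (Nat.zero_le _) (by omega), ← Finset.range_eq_Ico, hμ1]
  refine decAt_of_absorb_meanCondition x 0 j' M 0 hstar μ f hjM hμ0 hμM hμ1 hx0 hx1 hf0 hfμ hbal
    (fun h _ _ => Nat.zero_le h) (fun h h1 hlt => hh h h1 (lt_of_le_of_lt (hf0 h) hlt)) (by simp) ?_ ?_
  · rw [Nat.cast_zero, zero_mul, zero_add, sub_nonneg.symm]
    have : 0 ≤ x * (T - x * (hstar : ℝ)) := mul_nonneg hx0.le (by linarith)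
    linarith
  · have e1 : ∑ h ∈ Finset.range (j' + 1), (h : ℝ) * (μ h - f h) = ∑ h ∈ Finset.range (j' + 1), (h : ℝ) * μ h := by
      have : ∑ h ∈ Finset.range (j' + 1), (h : ℝ) * (μ h - f h)
          = ∑ h ∈ Finset.range (j' + 1), (h : ℝ) * μ h - ∑ h ∈ Finset.range (j' + 1), (h : ℝ) * f h := by
        rw [← Finset.sum_sub_distrib]; refine Finset.sum_congr rfl fun h _ => ?_; ring
      rw [this, hfmom, sub_zero]
    have hS1 : ∑ h ∈ Finset.range (j' + 1), μ h = 1 - PG := by linarith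
    have hST : ∑ h ∈ Finset.range (j' + 1), (h : ℝ) * μ h = T - ∑ h ∈ Finset.Ico (j' + 1) (M + 1), (h : ℝ) * μ h := by
      linarith
    rw [sub_zero, Finset.sum_sub_distrib, hfsum, e1, hS1, hST]
    have hcx : T * c = T * PG / x - T * PG := by rw [hc]; field_simp
    have hTc : T * (1 - PG - c) = T - T * PG - T * c := by ring
    rw [hTc, hcx]
    linarith [hEG]

end LawDec

end Quant

end Summit.CriticalPhenomena.PercolationContinuityZ3.Theorems
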